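import Literature.Barriers.PneNP.NegationLimitedGapProofs
import Literature.Barriers.PneNP.MonotoneGapLowerBoundProofs
import HarnessLib

/-!
# The negation-limited gap: what it rests on (reductions)

`Literature.Barriers.PneNP.NegationLimitedGap` (Jukna 2004; Jukna 2012, Thm. 10.21) is
proved from Tardos's monotone gap in `NegationLimitedGapProofs.lean`
(`NegationLimitedGap.of_monotoneGap : MonotoneGap → NegationLimitedGap`, with Claim 10.22
proved there), and `MonotoneGap` in turn is reduced in `MonotoneGapLowerBoundProofs.lean` to
the single named fact `Tardos1988_cliqueLike_polysize` (`MonotoneGap_of_polysize`; the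
exponential Alon–Boppana lower bound for `(⌊√n⌋ - 1, ⌊√n⌋)`-clique functions being PROVED in
`Literature/Computability/Complexity/CliqueSqrtLowerBound.lean`). This file records the
composite reduction, so that users of the barrier can condition on the one remaining
literature fact:

* `NegationLimitedGap.of_polysize : Tardos1988_cliqueLike_polysize → NegationLimitedGap`.

The remaining fact is the upper-bound half of Tardos (1988) / Jukna (2012), Lemma 9.27 and
Thm. 9.28: a `(⌊√n⌋ - 1, ⌊√n⌋)`-clique function with polynomial-size De Morgan circuits, i.e.
Lovász's sandwich `ω(G) ≤ ϑ(Ḡ) ≤ χ(G)` (proved in the tree,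
`Literature/Combinatorics/SimpleGraph/LovaszTheta.lean`) together with the
Grötschel–Lovász–Schrijver polynomial-time approximation of `ϑ` (the ellipsoid method — not
formalised).

## References

* S. Jukna, *Boolean Function Complexity* (2012), Thm. 10.21 and Claim 10.22 (PDF
  pp. 310–311), Lemma 9.27 / Thm. 9.28 (PDF p. 286), Thm. 9.26 (PDF p. 283) [Jukna2012] — held.
* É. Tardos, Combinatorica 8 (1988) 141–142 [Tardos1988] — held.
-/

noncomputable section

namespace Literature.Barriers.PneNP

/-- **`NegationLimitedGap` from Tardos's upper-bound fact alone** (Jukna 2012, Thm. 10.21 from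
Thm. 9.28): compose `MonotoneGap_of_polysize` (lower-bound half proved:
`Jukna2012_cliqueLike_sqrt_lowerBound_holds`) with `NegationLimitedGap.of_monotoneGap`
(Claim 10.22 proved: `Jukna2012_claim_10_22_holds`). After this, the negation-limited gap rests
on the single named fact `Tardos1988_cliqueLike_polysize`.
[cite: Jukna2012, Thm. 10.21 (PDF pp. 310–311) and Thm. 9.28 (PDF p. 286)] -/
theorem NegationLimitedGap.of_polysize (h : Tardos1988_cliqueLike_polysize) : NegationLimitedGap :=
  NegationLimitedGap.of_monotoneGap (MonotoneGap_of_polysize h)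

end Literature.Barriers.PneNP

end
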